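import Summits.Ventures.PercRepro.RankLevelSetIndepCDSplit

/-! # RankLevelSetIndepCDCross — THE (CD) PROFILES OF THE MINORS `M / f`, `M ∖ f` AS SLICES, AND THE INDUCTIVE STEP OF
(CD) WITH ITS CROSS TERM (night-1 g28; dossier §40)

With the splits `x_{k+1} = I^e_{k+1} + I^{ef}_k`, `y_{k+1} = I^∅_{k+1} + I^f_k` of `RankLevelSetIndepCDSplit`
(`I^A_k = sliceCount M e f A k`, `A ⊆ {e, f}`): THE MINORS — `contractCount (M / f) e k = I^{ef}_k` and
`deleteCount (M / f) e k = I^f_k` for a non-loop `f ≠ e`, `contractCount (M ∖ f) e k = I^e_k` and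
`deleteCount (M ∖ f) e k = I^∅_k`; for a loop `f` every slice through `f` vanishes. **THE INDUCTIVE STEP WITH ITS CROSS
TERM** (the «inductive lemma stated in PercRepro first» of the night-1 brief, for (CD)): the (CD) step
`x_{k+2} y_{k+1} ≤ x_{k+1} y_{k+2}` of `M` at `e` follows EXACTLY from the (CD) steps of `M ∖ f` (level `k + 1`) and of
`M / f` (level `k`) and the cross term `I^e_{k+2} I^f_k + I^{ef}_{k+1} I^∅_{k+1} ≤ I^e_{k+1} I^f_{k+1} + I^{ef}_k I^∅_{k+2}`
(`IndepCDCross M`, a `Prop`, NOT asserted; census-clean on every matroid with ≤ 8 elements — 96,544 `(M, e, f, k)`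
instances, 0 failures, night-1 g28 own exact code; it is the `v¹`-coefficient of the weighted (CD) difference with `f`
weighted `v`, hence a coarsening of the fibre statement (★★)_mid of `RankLevelSetIndepCD`). `cd_step_of_split` is the
arithmetic, `indepCDStep_of_split` the slice form, `indepCDStep_of_minors` the matroid form. Nothing here asserts (CD);
every declaration has a docstring; imports: the cell's own modules and Mathlib only. Axioms: standard. -/

namespace PercRepro

open Set Matroid Finset

variable {α : Type} (M : Matroid α) [M.Finite]

/-! ## The slices at `(e, f)` are the profiles of the contraction `M / f` -/

omit [M.Finite] in
/-- For a non-loop `f ≠ e`, `contractCount (M / f) e k = I^{ef}_k`. -/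
lemma contractCount_contract_eq_slice {e f : α} (hfe : f ≠ e) (hf : M.Indep {f}) (k : ℕ) :
    contractCount (M ／ {f}) e k = sliceCount M e f {e, f} k := by
  unfold contractCount sliceCount
  congr 1
  ext T
  simp only [Set.mem_setOf_eq, contract_ground, hf.contract_indep_iff]
  constructor
  · rintro ⟨hTE, hTcard, hdisj, hTind⟩
    refine ⟨?_, hTcard, ?_⟩
    · intro x hx
      have hxE := hTE hx
      simp only [Set.mem_sdiff, Set.mem_singleton_iff, Set.mem_insert_iff] at hxE ⊢
      exact ⟨hxE.1.1, fun h => h.elim hxE.2 hxE.1.2⟩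
    · have h1 : insert e T ∪ {f} = T ∪ {e, f} := by
        ext x
        simp only [Set.mem_union, Set.mem_singleton_iff, Set.mem_insert_iff]
        tauto
      rw [h1] at hTind; exact hTind
  · rintro ⟨hTE, hTcard, hTind⟩
    have hfT : f ∉ T := fun h => (hTE h).2 (by simp)
    refine ⟨?_, hTcard, ?_, ?_⟩
    · intro x hx
      have hxE := hTE hx
      simp only [Set.mem_sdiff, Set.mem_singleton_iff, Set.mem_insert_iff] at hxE ⊢
      exact ⟨⟨hxE.1, fun h => hxE.2 (Or.inr h)⟩, fun h => hxE.2 (Or.inl h)⟩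
    · rw [Set.disjoint_singleton_right]
      simp only [Set.mem_insert_iff, not_or]
      exact ⟨hfe, hfT⟩
    · have h1 : insert e T ∪ {f} = T ∪ {e, f} := by
        ext x
        simp only [Set.mem_union, Set.mem_singleton_iff, Set.mem_insert_iff]
        tauto
      rw [h1]; exact hTind

omit [M.Finite] in
/-- For a non-loop `f`, `deleteCount (M / f) e k = I^f_k`. -/
lemma deleteCount_contract_eq_slice {e f : α} (hf : M.Indep {f}) (k : ℕ) :
    deleteCount (M ／ {f}) e k = sliceCount M e f {f} k := by
  unfold deleteCount sliceCount
  congr 1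
  ext T
  simp only [Set.mem_setOf_eq, contract_ground, hf.contract_indep_iff]
  constructor
  · rintro ⟨hTE, hTcard, hdisj, hTind⟩
    refine ⟨?_, hTcard, hTind⟩
    intro x hx
    have hxE := hTE hx
    simp only [Set.mem_sdiff, Set.mem_singleton_iff, Set.mem_insert_iff] at hxE ⊢
    exact ⟨hxE.1.1, fun h => h.elim hxE.2 hxE.1.2⟩
  · rintro ⟨hTE, hTcard, hTind⟩
    have hfT : f ∉ T := fun h => (hTE h).2 (by simp)
    refine ⟨?_, hTcard, Set.disjoint_singleton_right.mpr hfT, hTind⟩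
    intro x hx
    have hxE := hTE hx
    simp only [Set.mem_sdiff, Set.mem_singleton_iff, Set.mem_insert_iff] at hxE ⊢
    exact ⟨⟨hxE.1, fun h => hxE.2 (Or.inr h)⟩, fun h => hxE.2 (Or.inl h)⟩

omit [M.Finite] in
/-- For a loop `f`, every slice through `f` vanishes. -/
lemma sliceCount_eq_zero_of_loop {e f : α} (hf : ¬ M.Indep {f}) (A : Set α) (hfA : f ∈ A) (k : ℕ) :
    sliceCount M e f A k = 0 := by
  unfold sliceCount
  have h : {T : Set α | T ⊆ M.E \ {e, f} ∧ T.ncard = k ∧ M.Indep (T ∪ A)} = (∅ : Set (Set α)) := by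
    ext T
    simp only [Set.mem_setOf_eq, Set.mem_empty_iff_false, iff_false, not_and]
    intro _ _ hTind
    exact hf (hTind.subset (Set.singleton_subset_iff.mpr (Set.mem_union_right _ hfA)))
  rw [h, Set.ncard_empty]


omit [M.Finite] in
/-- For `f ≠ e`, `contractCount (M ∖ f) e k = I^e_k` (the slice avoiding `f`). -/
lemma contractCount_delete_eq_slice {e f : α} (hfe : f ≠ e) (k : ℕ) :
    contractCount (M ＼ {f}) e k = sliceCount M e f {e} k := by
  unfold contractCount sliceCount
  congr 1
  ext T
  simp only [Set.mem_setOf_eq, delete_ground, delete_indep_iff, Set.union_singleton]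
  constructor
  · rintro ⟨hTE, hTcard, hTind, hdisj⟩
    refine ⟨?_, hTcard, hTind⟩
    intro x hx
    have hxE := hTE hx
    simp only [Set.mem_sdiff, Set.mem_singleton_iff, Set.mem_insert_iff] at hxE ⊢
    exact ⟨hxE.1.1, fun h => h.elim hxE.2 hxE.1.2⟩
  · rintro ⟨hTE, hTcard, hTind⟩
    have hfT : f ∉ T := fun h => (hTE h).2 (by simp)
    refine ⟨?_, hTcard, hTind, ?_⟩
    · intro x hx
      have hxE := hTE hx
      simp only [Set.mem_sdiff, Set.mem_singleton_iff, Set.mem_insert_iff] at hxE ⊢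
      exact ⟨⟨hxE.1, fun h => hxE.2 (Or.inr h)⟩, fun h => hxE.2 (Or.inl h)⟩
    · rw [Set.disjoint_singleton_right]
      simp only [Set.mem_insert_iff, not_or]
      exact ⟨hfe, hfT⟩

omit [M.Finite] in
/-- For any `f`, `deleteCount (M ∖ f) e k = I^∅_k` (the slice avoiding `f`). -/
lemma deleteCount_delete_eq_slice (e f : α) (k : ℕ) :
    deleteCount (M ＼ {f}) e k = sliceCount M e f ∅ k := by
  unfold deleteCount sliceCount
  congr 1
  ext T
  simp only [Set.mem_setOf_eq, delete_ground, delete_indep_iff, Set.union_empty]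
  constructor
  · rintro ⟨hTE, hTcard, hTind, -⟩
    refine ⟨?_, hTcard, hTind⟩
    intro x hx
    have hxE := hTE hx
    simp only [Set.mem_sdiff, Set.mem_singleton_iff, Set.mem_insert_iff] at hxE ⊢
    exact ⟨hxE.1.1, fun h => h.elim hxE.2 hxE.1.2⟩
  · rintro ⟨hTE, hTcard, hTind⟩
    have hfT : f ∉ T := fun h => (hTE h).2 (by simp)
    refine ⟨?_, hTcard, hTind, Set.disjoint_singleton_right.mpr hfT⟩
    intro x hx
    have hxE := hTE hx
    simp only [Set.mem_sdiff, Set.mem_singleton_iff, Set.mem_insert_iff] at hxE ⊢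
    exact ⟨⟨hxE.1, fun h => hxE.2 (Or.inr h)⟩, fun h => hxE.2 (Or.inl h)⟩

/-! ## The inductive step of (CD) with its cross term -/

omit [M.Finite] in
/-- **THE CROSS TERM OF THE (CD) INDUCTION** (a `Prop`, NOT asserted): for all `e ≠ f` in `E` and every `k`,
`I^e_{k+2} I^f_k + I^{ef}_{k+1} I^∅_{k+1} ≤ I^e_{k+1} I^f_{k+1} + I^{ef}_k I^∅_{k+2}` — the `v¹`-coefficient of the
weighted (CD) difference `x_{k+1}(v) y_{k+2}(v) − x_{k+2}(v) y_{k+1}(v)` with `f` weighted `v`. Census-clean on every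
matroid with at most 8 elements (96,544 instances, 0 failures; night-1 g28, own exact code). -/
def IndepCDCross : Prop :=
  ∀ e ∈ M.E, ∀ f ∈ M.E, f ≠ e → ∀ k : ℕ,
    sliceCount M e f {e} (k + 2) * sliceCount M e f {f} k + sliceCount M e f {e, f} (k + 1) * sliceCount M e f ∅ (k + 1) ≤
      sliceCount M e f {e} (k + 1) * sliceCount M e f {f} (k + 1) + sliceCount M e f {e, f} k * sliceCount M e f ∅ (k + 2)

/-- **The arithmetic of the split**: the TP2 step of a sum of two 2-row arrays (with the second shifted by one) follows
from the TP2 steps of the parts and the cross term. -/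
lemma cd_step_of_split {A A' B B' C C' D D' : ℕ} (h1 : A' * C ≤ A * C') (h2 : B' * D ≤ B * D')
    (hc : A' * D + B' * C ≤ A * D' + B * C') : (A' + B') * (C + D) ≤ (A + B) * (C' + D') := by
  nlinarith [h1, h2, hc]

/-- **THE INDUCTIVE STEP OF (CD) AT `e`, SPLIT AT `f ≠ e`**: the (CD) step of `M ∖ f` at level `k + 1`, the (CD) step of
`M / f` at level `k` (both in slice language) and the cross term give the (CD) step of `M` at level `k + 1`. -/
theorem indepCDStep_of_split {e f : α} (hfe : f ≠ e) (k : ℕ)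
    (hdel : sliceCount M e f {e} (k + 2) * sliceCount M e f ∅ (k + 1) ≤
      sliceCount M e f {e} (k + 1) * sliceCount M e f ∅ (k + 2))
    (hcon : sliceCount M e f {e, f} (k + 1) * sliceCount M e f {f} k ≤
      sliceCount M e f {e, f} k * sliceCount M e f {f} (k + 1))
    (hc : sliceCount M e f {e} (k + 2) * sliceCount M e f {f} k +
        sliceCount M e f {e, f} (k + 1) * sliceCount M e f ∅ (k + 1) ≤
      sliceCount M e f {e} (k + 1) * sliceCount M e f {f} (k + 1) +
        sliceCount M e f {e, f} k * sliceCount M e f ∅ (k + 2)) :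
    contractCount M e (k + 2) * deleteCount M e (k + 1) ≤ contractCount M e (k + 1) * deleteCount M e (k + 2) := by
  rw [contractCount_split M e f hfe (k + 1), contractCount_split M e f hfe k, deleteCount_split M e f hfe (k + 1),
    deleteCount_split M e f hfe k]
  exact cd_step_of_split hdel hcon hc

/-- **The matroid form of the step**: (CD) for `M ∖ f` and for `M / f` (non-loop `f ≠ e` in `E`) and the cross term at
`(e, f)` give the (CD) step of `M` at `e` and every level `k + 1`. -/
theorem indepCDStep_of_minors {e f : α} (he : e ∈ M.E) (hf : f ∈ M.E) (hfe : f ≠ e) (hfl : M.Indep {f})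
    (hdel : IndepCD (M ＼ {f})) (hcon : IndepCD (M ／ {f})) (hc : IndepCDCross M) (k : ℕ) :
    contractCount M e (k + 2) * deleteCount M e (k + 1) ≤ contractCount M e (k + 1) * deleteCount M e (k + 2) := by
  have heD : e ∈ (M ＼ {f}).E := by
    rw [delete_ground]; exact ⟨he, fun h => hfe (Set.mem_singleton_iff.mp h).symm⟩
  have heC : e ∈ (M ／ {f}).E := by
    rw [contract_ground]; exact ⟨he, fun h => hfe (Set.mem_singleton_iff.mp h).symm⟩
  have h1 := hdel e heD (k + 1)
  have h2 := hcon e heC k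
  rw [contractCount_delete_eq_slice M hfe, deleteCount_delete_eq_slice, contractCount_delete_eq_slice M hfe,
    deleteCount_delete_eq_slice] at h1
  rw [contractCount_contract_eq_slice M hfe hfl, deleteCount_contract_eq_slice M hfl,
    contractCount_contract_eq_slice M hfe hfl, deleteCount_contract_eq_slice M hfl] at h2
  exact indepCDStep_of_split M hfe k h1 h2 (hc e he f hf hfe k)

end PercRepro
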